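import Summits.QuantumFields.BalabanUV.T4Continuum.Support.NE3FramePotGauge
import Summits.QuantumFields.BalabanUV.T4Continuum.Support.AveragingDeficitTorusChart
import Mathlib.Analysis.InnerProductSpace.PiL2
import HarnessLib

/-!
# T⁴ programme, node NE3 — row E-MLw-(w4)-P, sub-row Φ6 (flat), file 2: THE ℓ²-PROJECTION ONTO THE CORNER-TRIVIAL,
# BLOCK-MEAN-ZERO GAUGE ORBIT ON THE FINITE TORUS (the «block-mean-zero Poisson step», abstract Hilbert-space half)

NE3 (node U1b) formalisation swarm `b2b-balaban-t4-ne3-formalise-*`, leaf seat `b2b-balaban-t4-ne3-formalise-leaf-01`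
(gen 5), row **Φ6** of ruling ρ-g21-3 ∕ `HOME/t4/b2b-balaban-t4-ne3-p1/g21/D-ne3p1-g21-2.md` §2; my CLAIM in `HOME/CLAIMS.log`
(2026-08-20 ≈15:39Z); row NE3-R2's scoping (ibid., ≈15:35Z): «beyond Φ1a only the block-mean-zero Poisson step (ℓ²-projection onto
`dPot Ξ₀₀`)».  File 1 = `NE3FrameFreeSliceUnique` (trivial intersection).

WHAT.  For a finite-dimensional real inner product space `E`, a period `P = M·N` and ANY `E`-valued lattice 1-form `Y`, there is
a `P`-periodic site field `ξ` which is CORNER-TRIVIAL (`ξ = 0` on `M•ℤ^d`) and BLOCK-MEAN-ZERO (`Σ_{v∈[0,M)^d} ξ(M•z + v) = 0` for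
every block `z`) such that `Y + dPot ξ` is `ℓ²(periodBox P)`-ORTHOGONAL to `dPot η` for every `P`-periodic corner-trivial
block-mean-zero `η` (`exists_orthogonal_repr`).  This is Mathlib's orthogonal decomposition
(`Submodule.exists_add_mem_mem_orthogonal`) in the finite-dimensional Hilbert space `PiLp 2` of torus 1-forms, applied to the
image of the sub-module `Ξ₀₀` of torus site fields under the coboundary; the rest is the dictionary torus ↔ periodic lattice
fields (`AveragingDeficitTorusChart.redN` ∕ `boxVec`).  File 3 turns the orthogonality into the BLOCK-LANDAU clause of
`NE3FrameFreeSlice.frameFreeBlockLandau` (backward divergence block-constant off corners) and assembles the matrix statement.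

CONTENT ([folklore]; 0 sorry; DATA defs `extT` (periodic extension of a torus site field), `xiSub` (the sub-module `Ξ₀₀`),
`dPotT` (the coboundary as an `ℝ`-linear map into torus 1-forms), `resT1` (restriction of a lattice 1-form) → async audit;
no `def … : Prop`): §1 the dictionary; §2 `xiSub`, `dPotT`, `resT1`; §3 the `PiLp 2` inner product as a sum over `periodBox P`;
§4 **`exists_orthogonal_repr`**.

HONEST FRAMING.  Finite-dimensional linear algebra on our lattice objects; nothing about Bałaban's minimisers; (P_W), (ML_w),
(μK)♮, T-E_w and **NE3 are NOT proved**; spine PROVED 0∕9; finite T⁴ rung (B)+1 — NOT infinite volume, NOT mass gap, NOT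
`BetaPertH`, NOT Clay.  PLACEMENT: `Summits/QuantumFields/BalabanUV/`.  HONEST DEPENDENCY (cell page 1): continuum YM on T⁴ ⇐
BetaPertH ∧ nine spine estimates (0/9 proved); BetaPertH ⇐ (D1) ∧ (D4) ∧ CAP+tail; G-an2-4 gates asym, D1 and NE2/3/4.
-/

set_option autoImplicit false

open scoped BigOperators InnerProductSpace
open Finset

namespace Summit.QuantumFields.BalabanUV.T4Continuum.NE3TorusProjection

open Literature.MathematicalPhysics.QuantumFieldTheory.Balaban1983to89
open B7Prop1Explicit
open T4AveragingDeficitWallBoundary (periodBox)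
open AveragingDeficitTorusChart (redN redN_boxVec redN_add_smul eq_wrap_add periodic_smul_vec)
open NE3BlockLineAverage (sum_univ_boxVec)

noncomputable section

variable {d : ℕ}
variable {E : Type*} [NormedAddCommGroup E] [InnerProductSpace ℝ E]

/-! ## §1 The torus dictionary for site fields -/

omit [InnerProductSpace ℝ E] in
/-- The lattice COBOUNDARY of an `E`-valued site field: `cobd ξ x κ = ξ (x + e_κ) − ξ x` (the tree's `NE3TangentNoGoWords.dPot`,
which is stated for normed rings, read for a general normed group; definitionally equal on `ℂ`). [folklore] -/
def cobd (ξ : Site d → E) : Site d → Fin d → E := fun x κ => ξ (x + e κ) - ξ x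

omit [InnerProductSpace ℝ E] in
/-- `cobd ξ x κ = ξ (x + e κ) − ξ x`. [folklore] -/
theorem cobd_apply (ξ : Site d → E) (x : Site d) (κ : Fin d) : cobd ξ x κ = ξ (x + e κ) - ξ x := rfl

omit [InnerProductSpace ℝ E] in
/-- The coboundary of a negated site field. [folklore] -/
theorem cobd_neg (ξ : Site d → E) (x : Site d) (κ : Fin d) : cobd (fun y => -ξ y) x κ = -cobd ξ x κ := by
  simp only [cobd]; abel

/-- Periodic extension of a torus site field `a : (Fin d → Fin P) → E` to the lattice: `extT a x = a (x mod P)`. [folklore] -/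
def extT (P : ℕ) [NeZero P] (a : PiLp 2 (fun _ : (Fin d → Fin P) => E)) : Site d → E := fun x => a (redN P x)

omit [NormedAddCommGroup E] [InnerProductSpace ℝ E] in
/-- `extT a` is `P`-periodic along every axis. [folklore] -/
theorem extT_add_period (P : ℕ) [NeZero P] (a : PiLp 2 (fun _ : (Fin d → Fin P) => E)) (x : Site d) (τ : Fin d) :
    extT P a (x + (P : ℤ) • e τ) = extT P a x := by
  unfold extT; rw [redN_add_smul]

omit [NormedAddCommGroup E] [InnerProductSpace ℝ E] in
/-- `extT` on the representatives. [folklore] -/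
theorem extT_boxVec (P : ℕ) [NeZero P] (a : PiLp 2 (fun _ : (Fin d → Fin P) => E)) (r : Fin d → Fin P) :
    extT P a (boxVec P r) = a r := by
  unfold extT; rw [redN_boxVec]

omit [InnerProductSpace ℝ E] in
/-- `extT` is additive. [folklore] -/
theorem extT_add (P : ℕ) [NeZero P] (a b : PiLp 2 (fun _ : (Fin d → Fin P) => E)) (x : Site d) :
    extT P (a + b) x = extT P a x + extT P b x := rfl

/-- `extT` is homogeneous. [folklore] -/
theorem extT_smul (P : ℕ) [NeZero P] (c : ℝ) (a : PiLp 2 (fun _ : (Fin d → Fin P) => E)) (x : Site d) :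
    extT P (c • a) x = c • extT P a x := rfl

omit [InnerProductSpace ℝ E] in
/-- `extT 0 = 0`. [folklore] -/
theorem extT_zero (P : ℕ) [NeZero P] (x : Site d) : extT P (0 : PiLp 2 (fun _ : (Fin d → Fin P) => E)) x = 0 := rfl

omit [NormedAddCommGroup E] [InnerProductSpace ℝ E] in
/-- The restriction of a `P`-periodic site field extends back to itself. [folklore] -/
theorem extT_toLp_eq (P : ℕ) [NeZero P] {η : Site d → E} (hη : ∀ (x : Site d) (τ : Fin d), η (x + (P : ℤ) • e τ) = η x)
    (x : Site d) : extT P (WithLp.toLp 2 fun r : Fin d → Fin P => η (boxVec P r)) x = η x := by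
  show η (boxVec P (redN P x)) = η x
  conv_rhs => rw [eq_wrap_add P x]
  rw [periodic_smul_vec hη]

/-! ## §2 The sub-module `Ξ₀₀` of torus site fields, the coboundary, the restriction -/

variable (d E) in
/-- **`Ξ₀₀`**: the torus site fields whose periodic extension is CORNER-TRIVIAL (`= 0` on `M•ℤ^d`) and BLOCK-MEAN-ZERO
(`Σ_{v∈[0,M)^d} ξ(M•z + v) = 0` for every block `z`) — a real sub-module. [folklore] -/
def xiSub (M P : ℕ) [NeZero P] : Submodule ℝ (PiLp 2 (fun _ : (Fin d → Fin P) => E)) where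
  carrier := {a | (∀ w : Site d, extT P a ((M : ℤ) • w) = 0)
    ∧ ∀ z : Site d, ∑ v ∈ periodBox (d := d) M, extT P a ((M : ℤ) • z + v) = 0}
  zero_mem' := ⟨fun _ => rfl, fun z => by simp [extT_zero]⟩
  add_mem' := by
    rintro a b ⟨ha1, ha2⟩ ⟨hb1, hb2⟩
    refine ⟨fun w => ?_, fun z => ?_⟩
    · rw [extT_add, ha1, hb1, add_zero]
    · simp only [extT_add, sum_add_distrib, ha2, hb2, add_zero]
  smul_mem' := by
    rintro c a ⟨ha1, ha2⟩
    refine ⟨fun w => ?_, fun z => ?_⟩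
    · rw [extT_smul, ha1, smul_zero]
    · simp only [extT_smul, ← smul_sum, ha2, smul_zero]

/-- Membership in `Ξ₀₀`, unfolded. [folklore] -/
theorem mem_xiSub {M P : ℕ} [NeZero P] {a : PiLp 2 (fun _ : (Fin d → Fin P) => E)} :
    a ∈ xiSub d E M P ↔ (∀ w : Site d, extT P a ((M : ℤ) • w) = 0)
      ∧ ∀ z : Site d, ∑ v ∈ periodBox (d := d) M, extT P a ((M : ℤ) • z + v) = 0 := Iff.rfl

/-- Restriction of a lattice 1-form to the torus representatives, as an element of `PiLp 2`. [folklore] -/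
def resT1 (P : ℕ) (Y : Site d → Fin d → E) : PiLp 2 (fun _ : (Fin d → Fin P) × Fin d => E) :=
  WithLp.toLp 2 fun p => Y (boxVec P p.1) p.2

omit [NormedAddCommGroup E] [InnerProductSpace ℝ E] in
/-- `resT1 Y` evaluated. [folklore] -/
theorem resT1_apply (P : ℕ) (Y : Site d → Fin d → E) (p : (Fin d → Fin P) × Fin d) : resT1 P Y p = Y (boxVec P p.1) p.2 := rfl

omit [InnerProductSpace ℝ E] in
/-- `resT1` is additive in the 1-form. [folklore] -/
theorem resT1_add (P : ℕ) (Y Z : Site d → Fin d → E) :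
    resT1 P (fun x κ => Y x κ + Z x κ) = resT1 P Y + resT1 P Z := by
  ext p; rfl

omit [InnerProductSpace ℝ E] in
/-- `resT1` commutes with negation. [folklore] -/
theorem resT1_neg (P : ℕ) (Y : Site d → Fin d → E) : resT1 P (fun x κ => -Y x κ) = -resT1 P Y := by
  ext p; rfl

/-- **THE COBOUNDARY AS AN `ℝ`-LINEAR MAP INTO TORUS 1-FORMS**: `dPotT a = resT1 (cobd (extT a))`. [folklore] -/
def dPotT (P : ℕ) [NeZero P] :
    PiLp 2 (fun _ : (Fin d → Fin P) => E) →ₗ[ℝ] PiLp 2 (fun _ : (Fin d → Fin P) × Fin d => E) where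
  toFun a := resT1 P (cobd (extT P a))
  map_add' a b := by
    ext p
    simp only [resT1_apply, PiLp.add_apply, cobd, extT_add]
    abel
  map_smul' c a := by
    ext p
    simp only [resT1_apply, PiLp.smul_apply, cobd, extT_smul, RingHom.id_apply, smul_sub]

/-- `dPotT a = resT1 (cobd (extT a))`. [folklore] -/
theorem dPotT_apply (P : ℕ) [NeZero P] (a : PiLp 2 (fun _ : (Fin d → Fin P) => E)) :
    dPotT P a = resT1 P (cobd (extT P a)) := rfl

/-! ## §3 Inner products on the torus are sums over the period box -/

/-- **`⟪resT1 F, resT1 G⟫ = Σ_{x∈periodBox P} Σ_κ ⟪F x κ, G x κ⟫`**. [folklore] -/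
theorem inner_resT1 (P : ℕ) (F G : Site d → Fin d → E) :
    ⟪resT1 P F, resT1 P G⟫_ℝ = ∑ x ∈ periodBox (d := d) P, ∑ κ : Fin d, ⟪F x κ, G x κ⟫_ℝ := by
  rw [PiLp.inner_apply, Fintype.sum_prod_type,
    ← sum_univ_boxVec P (fun x => ∑ κ : Fin d, ⟪F x κ, G x κ⟫_ℝ)]
  rfl

/-! ## §4 The orthogonal representative -/

/-- **THE BLOCK-MEAN-ZERO POISSON STEP (abstract half)**: for `M, N ≥ 1` and any `E`-valued lattice 1-form `Y` (`E` a
finite-dimensional real inner product space) there is a `(M·N)`-periodic, CORNER-TRIVIAL, BLOCK-MEAN-ZERO site field `ξ` such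
that `Y + cobd ξ` is `ℓ²(periodBox (M·N))`-orthogonal to `cobd η` for every `(M·N)`-periodic corner-trivial block-mean-zero `η`
(Mathlib's `Submodule.exists_add_mem_mem_orthogonal` for the image of `Ξ₀₀` under `dPotT`). [folklore] -/
theorem exists_orthogonal_repr [FiniteDimensional ℝ E] {M N : ℕ} (hM : 1 ≤ M) (hN : 1 ≤ N) (Y : Site d → Fin d → E) :
    ∃ ξ : Site d → E,
      (∀ (x : Site d) (τ : Fin d), ξ (x + ((M * N : ℕ) : ℤ) • e τ) = ξ x) ∧
      (∀ w : Site d, ξ ((M : ℤ) • w) = 0) ∧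
      (∀ z : Site d, ∑ v ∈ periodBox (d := d) M, ξ ((M : ℤ) • z + v) = 0) ∧
      ∀ η : Site d → E, (∀ (x : Site d) (τ : Fin d), η (x + ((M * N : ℕ) : ℤ) • e τ) = η x) →
        (∀ w : Site d, η ((M : ℤ) • w) = 0) → (∀ z : Site d, ∑ v ∈ periodBox (d := d) M, η ((M : ℤ) • z + v) = 0) →
        ∑ x ∈ periodBox (d := d) (M * N), ∑ κ : Fin d, ⟪cobd η x κ, Y x κ + cobd ξ x κ⟫_ℝ = 0 := by
  set P : ℕ := M * N with hPdef
  haveI : NeZero P := ⟨by positivity⟩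
  -- the closed sub-module `dPot Ξ₀₀` of the torus 1-forms
  set K : Submodule ℝ (PiLp 2 (fun _ : (Fin d → Fin P) × Fin d => E)) := (xiSub d E M P).map (dPotT P) with hK
  haveI : CompleteSpace K := FiniteDimensional.complete ℝ K
  obtain ⟨r, hr, zz, hz, hyz⟩ := K.exists_add_mem_mem_orthogonal (resT1 P Y)
  obtain ⟨a, ha, har⟩ := Submodule.mem_map.1 hr
  obtain ⟨ha1, ha2⟩ := (mem_xiSub (d := d) (E := E)).1 ha
  refine ⟨fun x => -extT P a x, fun x τ => ?_, fun w => ?_, fun z => ?_, fun η hηP hηc hηb => ?_⟩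
  · show -extT P a (x + ((M * N : ℕ) : ℤ) • e τ) = -extT P a x
    rw [← hPdef, extT_add_period]
  · show -extT P a ((M : ℤ) • w) = 0
    rw [ha1, neg_zero]
  · show ∑ v ∈ periodBox (d := d) M, -extT P a ((M : ℤ) • z + v) = 0
    rw [sum_neg_distrib, ha2, neg_zero]
  · -- the test element `b := η|torus` lies in `Ξ₀₀`, so `dPotT b ∈ K ⊥ zz = resT1 (Y + dPot ξ)`
    set b : PiLp 2 (fun _ : (Fin d → Fin P) => E) := WithLp.toLp 2 fun s : Fin d → Fin P => η (boxVec P s) with hb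
    have hbext : extT P b = η := funext fun x => extT_toLp_eq P hηP x
    have hbmem : b ∈ xiSub d E M P := by
      rw [mem_xiSub, hbext]; exact ⟨hηc, hηb⟩
    have hbK : dPotT P b ∈ K := Submodule.mem_map_of_mem hbmem
    have horth : ⟪dPotT P b, zz⟫_ℝ = 0 := Submodule.inner_right_of_mem_orthogonal hbK hz
    have hzz : zz = resT1 P (fun x κ => Y x κ + cobd (fun y => -extT P a y) x κ) := by
      have h1 : zz = resT1 P Y - r := by rw [hyz]; abel
      rw [h1, ← har, dPotT_apply]
      ext p
      simp only [PiLp.sub_apply, resT1_apply, cobd]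
      abel
    rw [hzz, dPotT_apply, hbext, inner_resT1] at horth
    exact horth

end

end Summit.QuantumFields.BalabanUV.T4Continuum.NE3TorusProjection
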